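import Summits.QuantumFields.YangMills.Theorems.BalabanUVNodesN07DbarHQnear
import HarnessLib

/-!
# N07 [B11] (= [15] = [Balaban1985Variational]) Sect. F — MODULE 99b: **THE FIVE NUMERIC GUARDS OF (c′)‴ ARE JOINTLY SATISFIABLE** (A6-style non-vacuity certificate for MODULE 99
# `hQnear_dbar_of_guards` ∕ MODULE 100 `prop8RegSepTopStepG_of_hThm4RecDbar_cprime`): for every block size `L`, grid cube `Mc`, collar `ρ` and (152)-letter `κ ≥ 0` there are
# `a₀, a₁ > 0` with `243200·ℓ²·(κ·a₀·L) ≤ 1`, `60·ℓ²·(κ·a₀·L) < δ_N`, `t_c·a₁ < δ_N`, `600ℓ·τ_c·a₁ ≤ 1`, `X₀·a₁ ≤ ½` — the assembler's «shrink `a₀`, `a₁` AFTER `ρ`, `Mc`, `κ`» (print (163))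

Cell `pub-ymgap`, seat `pub-ymgap-dag-n07-e` g28 (FAN-OUT §N07 row s3; LANE OWNER of the K0 road chart side), MODULE 99b (rides with INTENT-99∕100; honesty certificate).
`--kind proof --supports stmt-QuantumFields-20541 --as helper` (K0⁷); count-neutral; ONE theorem (0 `def`).  [15] = [Balaban1985Variational]; [3] = [Balaban1985Averaging].

WHY.  MODULES 99∕100 display five numeric guards on the tolerance ceilings `a₀` (ε-side) and `a₁` (δ-side); a referee's vacuity audit (A1–A6) asks whether they can hold together with
`0 < a₀`, `0 < a₁` (the token's ranges `B₃·δ_j ≤ ε_j ≤ a₀`, `δ_j ≤ a₁` are then inhabited by small tolerances).  They can, for EVERY `L, Mc, ρ, κ ≥ 0, N ≥ 1`: all five are upper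
bounds on `a₀`∕`a₁` by positive quantities (`δ_N = min(1∕3, π∕N) > 0`).  This is print's order of choices ((163) p. 304: «ε₀ sufficiently small» after `R₁M₁`, `B₁`).

WHAT IS PROVED (sorry-free; axioms standard).  ★ `exists_guards_dbar (F N)` — the header's `∃ a₀ a₁`, with the guards spelled EXACTLY as in `hQnear_dbar_of_guards`.
HONEST SCOPE: an arithmetic witness; nothing of [15] asserted; it does NOT choose the knit's other letters (`B₃, C, θ, Q`, the budget row — MODULE 85's kit and the K0 assembler);
K0⁷ NOT closed; N07 NOT discharged; counts unmoved; one finite 𝕋⁴ programme at fixed ε — the route closes the conditional finite-𝕋⁴ rung `BalabanLadder.UV` ONLY; the YM mass gap (Clay) is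
NOT proved by any of this; nothing continuum ∕ ℝ⁴ ∕ OS.  No `def`, no `instance`, no `notation`, no `sorry`.

References: [15] (162)–(163) p. 304, (152) p. 301; [3] (26) p. 22 (the guard `δ_N` of the (0.4) logarithm).
-/

set_option autoImplicit false

noncomputable section

namespace Summit.QuantumFields.YangMills.BalabanUVNodes.N07DbarHQnearGuards

open Literature.MathematicalPhysics.QuantumFieldTheory.Balaban1983to89
open T4Continuum (T4Family)
open ExpMeanLog (deltaSU deltaSU_pos)
open B8Eq131Cubes (crad)

variable (F : T4Family) (N : ℕ) [NeZero N]

/-- ★ **THE FIVE GUARDS OF (c′)‴ HOLD FOR SMALL POSITIVE `a₀`, `a₁`** (any `L`, `Mc`, `ρ`, `κ ≥ 0`, `N ≥ 1`): witnesses `a₀ := min 1 (δ_N∕2) ∕ (243200·ℓ²·κ·L + 1)`,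
`a₁ := min (1∕2) (δ_N∕2) ∕ (X₀ + 600ℓ·τ_c + t_c + 1)`. [cite: Balaban1985Variational, (163) p.304; Balaban1985Averaging, (26) p.22] -/
theorem exists_guards_dbar (Mc ρ : ℕ) {κ : ℝ} (hκ : 0 ≤ κ) :
    ∃ a₀ a₁ : ℝ, 0 < a₀ ∧ 0 < a₁ ∧
      243200 * (((4 + 2) * F.L : ℕ) : ℝ) ^ 2 * (κ * a₀ * (F.L : ℝ)) ≤ 1 ∧
      60 * (((4 + 2) * F.L : ℕ) : ℝ) ^ 2 * (κ * a₀ * (F.L : ℝ)) < deltaSU (Fin N) ∧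
      ((((4 + 2) * F.L : ℕ) : ℝ) ^ 2 / 4) * ((4 * (((4 - 1 : ℕ) : ℝ) * ((2 * F.L - 1 : ℕ) : ℝ)) + 1) * a₁) < deltaSU (Fin N) ∧
      600 * (((4 + 2) * F.L : ℕ) : ℝ) * (((4 * (F.L - 1) + 1 : ℕ) : ℝ) * ((((4 - 1 : ℕ) : ℝ) * ((F.L - 1 : ℕ) : ℝ)) * a₁)) ≤ 1 ∧
      (2 * (((4 - 1 : ℕ) : ℝ) * ((crad (ρ * ((Mc + 11 * 4) / ρ + 2)) ρ : ℕ) : ℝ) * (1 + 2 * (((F.L : ℝ) ^ 2 + 6 * (((4 + 2) * F.L : ℕ) : ℝ) ^ 2) * (4 * (((4 - 1 : ℕ) : ℝ) * ((2 * F.L - 1 : ℕ) : ℝ)) + 1)))) + 10 * (((4 + 2) * F.L : ℕ) : ℝ) * (((4 * (F.L - 1) + 1 : ℕ) : ℝ) * (((4 - 1 : ℕ) : ℝ) * ((F.L - 1 : ℕ) : ℝ))) + 14 * ((((4 + 2) * F.L : ℕ) : ℝ) ^ 2 / 4 * (4 * (((4 - 1 : ℕ) : ℝ) * ((2 * F.L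 - 1 : ℕ) : ℝ)) + 1)) + 2 * (((4 + 1) * (F.L - 1) : ℕ) : ℝ) * (((4 * (F.L - 1) + 1 : ℕ) : ℝ) * (((4 - 1 : ℕ) : ℝ) * ((F.L - 1 : ℕ) : ℝ)))) * a₁ ≤ 1 / 2 := by
  have hδ : 0 < deltaSU (Fin N) := deltaSU_pos
  -- the δ-free coefficients
  obtain ⟨G₀, hG₀def⟩ : ∃ G₀ : ℝ, G₀ = 243200 * (((4 + 2) * F.L : ℕ) : ℝ) ^ 2 * (κ * (F.L : ℝ)) := ⟨_, rfl⟩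
  obtain ⟨G₁, hG₁def⟩ : ∃ G₁ : ℝ, G₁ = 60 * (((4 + 2) * F.L : ℕ) : ℝ) ^ 2 * (κ * (F.L : ℝ)) := ⟨_, rfl⟩
  obtain ⟨T₁, hT₁def⟩ : ∃ T₁ : ℝ, T₁ = ((((4 + 2) * F.L : ℕ) : ℝ) ^ 2 / 4) * (4 * (((4 - 1 : ℕ) : ℝ) * ((2 * F.L - 1 : ℕ) : ℝ)) + 1) := ⟨_, rfl⟩
  obtain ⟨T₂, hT₂def⟩ : ∃ T₂ : ℝ, T₂ = 600 * (((4 + 2) * F.L : ℕ) : ℝ) * (((4 * (F.L - 1) + 1 : ℕ) : ℝ) * (((4 - 1 : ℕ) : ℝ) * ((F.L - 1 : ℕ) : ℝ))) := ⟨_, rfl⟩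
  obtain ⟨X0, hX0def⟩ : ∃ X0 : ℝ, X0 = (2 * (((4 - 1 : ℕ) : ℝ) * ((crad (ρ * ((Mc + 11 * 4) / ρ + 2)) ρ : ℕ) : ℝ) * (1 + 2 * (((F.L : ℝ) ^ 2 + 6 * (((4 + 2) * F.L : ℕ) : ℝ) ^ 2) * (4 * (((4 - 1 : ℕ) : ℝ) * ((2 * F.L - 1 : ℕ) : ℝ)) + 1)))) + 10 * (((4 + 2) * F.L : ℕ) : ℝ) * (((4 * (F.L - 1) + 1 : ℕ) : ℝ) * (((4 - 1 : ℕ) : ℝ) * ((F.L - 1 : ℕ) : ℝ))) + 14 * ((((4 + 2) * F.L : ℕ) : ℝ) ^ 2 / 4 * (4 * (((4 - 1 : ℕ) : ℝ) * ((2 * F.L - 1 : ℕ) : ℝ)) + 1)) + 2 * (((4 + 1) * (F.L - 1) : ℕ) : ℝ) * (((4 * (F.L - 1) + 1 : ℕ) : ℝ) * (((4 - 1 : ℕ) : ℝ) * ((F.L - 1 : ℕ) : ℝ)))) := ⟨_, rfl⟩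
  have hG₀0 : 0 ≤ G₀ := by rw [hG₀def]; positivity
  have hG₁0 : 0 ≤ G₁ := by rw [hG₁def]; positivity
  have hT₁0 : 0 ≤ T₁ := by rw [hT₁def]; positivity
  have hT₂0 : 0 ≤ T₂ := by rw [hT₂def]; positivity
  have hX00 : 0 ≤ X0 := by rw [hX0def]; positivity
  have hG₁G₀ : G₁ ≤ G₀ := by
    rw [hG₀def, hG₁def]
    exact mul_le_mul_of_nonneg_right (mul_le_mul_of_nonneg_right (by norm_num) (pow_nonneg (Nat.cast_nonneg _) 2)) (mul_nonneg hκ (Nat.cast_nonneg _))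
  -- the witnesses
  set m₀ : ℝ := min 1 (deltaSU (Fin N) / 2) with hm₀
  set m₁ : ℝ := min (1 / 2) (deltaSU (Fin N) / 2) with hm₁
  have hm₀0 : 0 < m₀ := lt_min one_pos (by positivity)
  have hm₁0 : 0 < m₁ := lt_min (by norm_num) (by positivity)
  have hm₀1 : m₀ ≤ 1 := min_le_left _ _
  have hm₀δ : m₀ ≤ deltaSU (Fin N) / 2 := min_le_right _ _
  have hm₁h : m₁ ≤ 1 / 2 := min_le_left _ _
  have hm₁δ : m₁ ≤ deltaSU (Fin N) / 2 := min_le_right _ _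
  refine ⟨m₀ / (G₀ + 1), m₁ / (X0 + T₂ + T₁ + 1), by positivity, by positivity, ?_, ?_, ?_, ?_, ?_⟩
  · -- `G₀·a₀ ≤ m₀ ≤ 1`
    have e : 243200 * (((4 + 2) * F.L : ℕ) : ℝ) ^ 2 * (κ * (m₀ / (G₀ + 1)) * (F.L : ℝ)) = G₀ * (m₀ / (G₀ + 1)) := by rw [hG₀def]; ring
    rw [e]
    have h1 : G₀ * (m₀ / (G₀ + 1)) ≤ m₀ := by
      rw [mul_div_assoc']
      refine div_le_of_le_mul₀ (by positivity) hm₀0.le ?_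
      rw [mul_comm]
      exact mul_le_mul_of_nonneg_left (by linarith) hm₀0.le
    exact h1.trans hm₀1
  · have e : 60 * (((4 + 2) * F.L : ℕ) : ℝ) ^ 2 * (κ * (m₀ / (G₀ + 1)) * (F.L : ℝ)) = G₁ * (m₀ / (G₀ + 1)) := by rw [hG₁def]; ring
    rw [e]
    have h1 : G₁ * (m₀ / (G₀ + 1)) ≤ m₀ := by
      rw [mul_div_assoc']
      refine div_le_of_le_mul₀ (by positivity) hm₀0.le ?_
      rw [mul_comm]
      exact mul_le_mul_of_nonneg_left (by linarith) hm₀0.le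
    linarith
  · have e : ((((4 + 2) * F.L : ℕ) : ℝ) ^ 2 / 4) * ((4 * (((4 - 1 : ℕ) : ℝ) * ((2 * F.L - 1 : ℕ) : ℝ)) + 1) * (m₁ / (X0 + T₂ + T₁ + 1))) = T₁ * (m₁ / (X0 + T₂ + T₁ + 1)) := by
      rw [hT₁def]; ring
    rw [e]
    have h1 : T₁ * (m₁ / (X0 + T₂ + T₁ + 1)) ≤ m₁ := by
      rw [mul_div_assoc']
      refine div_le_of_le_mul₀ (by positivity) hm₁0.le ?_
      rw [mul_comm]
      exact mul_le_mul_of_nonneg_left (by linarith) hm₁0.le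
    linarith
  · have e : 600 * (((4 + 2) * F.L : ℕ) : ℝ) * (((4 * (F.L - 1) + 1 : ℕ) : ℝ) * ((((4 - 1 : ℕ) : ℝ) * ((F.L - 1 : ℕ) : ℝ)) * (m₁ / (X0 + T₂ + T₁ + 1)))) = T₂ * (m₁ / (X0 + T₂ + T₁ + 1)) := by
      rw [hT₂def]; ring
    rw [e]
    have h1 : T₂ * (m₁ / (X0 + T₂ + T₁ + 1)) ≤ m₁ := by
      rw [mul_div_assoc']
      refine div_le_of_le_mul₀ (by positivity) hm₁0.le ?_
      rw [mul_comm]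
      exact mul_le_mul_of_nonneg_left (by linarith) hm₁0.le
    linarith
  · rw [← hX0def]
    have h1 : X0 * (m₁ / (X0 + T₂ + T₁ + 1)) ≤ m₁ := by
      rw [mul_div_assoc']
      refine div_le_of_le_mul₀ (by positivity) hm₁0.le ?_
      rw [mul_comm]
      exact mul_le_mul_of_nonneg_left (by linarith) hm₁0.le
    linarith

end Summit.QuantumFields.YangMills.BalabanUVNodes.N07DbarHQnearGuards

end
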